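import Summits.ValiantsHypothesis.ValiantsHypothesis.Theorems.GrenetZeonDualUnipotentThreeHalvesLongMassRankOneTriangular
import Summits.ValiantsHypothesis.ValiantsHypothesis.Theorems.GrenetZeonDualUnipotentThreeHalvesHeavyTopPatternDefs

/-!
# `GrenetZeon.DualUnipotentThreeHalves` (stmt-ValiantsHypothesis-24318), line `slow_core`, stub `stub_longMassSlowLawInv` ((c)):
# EVERY NILPOTENT COORDINATE-PATTERN PENCIL IS (c)-CHEAP — nilpotency alone, no acyclicity hypothesis

By-name corollary of ✓ `relCert_of_rankOne_generated` (`…LongMassRankOneTriangular`): the coordinate pattern pencil ✓ `RadicalSplit.patPencil pos`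
(coordinate `x_c` placed at position `pos c`; several coordinates may share a position, positions may lie anywhere) has outer-product coefficients
`[x_c] N = δ_{(pos c).1} δ_{(pos c).2}ᵀ` and constant part `0`, so ★ `relCert_patPencil_of_pow_eq_zero`: `(patPencil pos) ^ H = 0` ALONE gives
`RelCert n m (patPencil pos) (3·(⌊√n⌋·m))`.  This removes the acyclicity / strict-upper hypotheses of the landed pattern rows ✓
`TriangularRow.relCert_patPencil_of_graded` / `relCert_patPencil_of_strictUpper` (the level function is now DERIVED from nilpotency through the
hereditarily-nilpotent Gram matrix, ✓ `exists_levels_of_hereditarilyNilpotent`).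

Honest framing: support row (`--supports stmt-ValiantsHypothesis-24318`); pattern pencils are never `IrreducibleInv` of size `≥ 2`; NOT progress on
(c) `SlowCore.LongMassSlowLawInv`, which with S3, 24318, 8062, VP ≠ VNP stays OPEN / NOT proved.  No sorry, no definitions, no named facts.
-/

-- single-conjunct layout: Sub = Summit, duplicated namespace component intended (the name is mandated)
set_option linter.dupNamespace false
set_option autoImplicit false

noncomputable section

namespace Summit.ValiantsHypothesis.ValiantsHypothesis.Theorems.GrenetZeon.LongMassRankOne

open MvPolynomial Matrix
open scoped BigOperators
open Summit.ValiantsHypothesis.ValiantsHypothesis.Cruxes.TwoDimCoefficients.DimTwoCases (AffMat IsAffine)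
open Summit.ValiantsHypothesis.ValiantsHypothesis.Theorems.GrenetZeon.SlowCore (RelCert)
open Summit.ValiantsHypothesis.ValiantsHypothesis.Theorems.GrenetZeon.RadicalSplit (patTop patPencil isAffine_patPencil)

variable {n m : ℕ}

/-- The pattern pencil has constant part `0`. -/
theorem coeff_zero_patPencil (pos : Fin n × Fin n → Fin m × Fin m) (i j : Fin m) : coeff 0 (patPencil pos i j) = 0 := by
  classical
  show coeff 0 (∑ c, if pos c = (i, j) then (X c : MvPolynomial (Fin n × Fin n) ℂ) else 0) = 0
  rw [coeff_sum]
  refine Finset.sum_eq_zero fun c _ => ?_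
  split_ifs
  · rw [coeff_X, if_neg]
    exact fun h => one_ne_zero (Finsupp.single_eq_zero.mp h)
  · exact coeff_zero _

/-- The coefficient matrix of the coordinate `e` in the pattern pencil is the matrix unit at `pos e`, an outer product. -/
theorem coeff_single_patPencil (pos : Fin n × Fin n → Fin m × Fin m) (e : Fin n × Fin n) (i j : Fin m) :
    coeff (Finsupp.single e 1) (patPencil pos i j) =
      (Pi.single (pos e).1 (1 : ℂ) : Fin m → ℂ) i * (Pi.single (pos e).2 (1 : ℂ) : Fin m → ℂ) j := by
  classical
  show coeff (Finsupp.single e 1) (∑ c, if pos c = (i, j) then (X c : MvPolynomial (Fin n × Fin n) ℂ) else 0) = _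
  rw [coeff_sum]
  have hc : ∀ c, coeff (Finsupp.single e 1) (if pos c = (i, j) then (X c : MvPolynomial (Fin n × Fin n) ℂ) else 0) =
      if c = e then (if pos e = (i, j) then 1 else 0) else 0 := by
    intro c
    by_cases hce : c = e
    · subst hce
      rw [if_pos rfl]
      split_ifs
      · rw [coeff_X, if_pos rfl]
      · exact coeff_zero _
    · rw [if_neg hce]
      split_ifs
      · rw [coeff_X, if_neg]
        intro h
        exact hce (Finsupp.single_left_injective one_ne_zero h)
      · exact coeff_zero _
  simp_rw [hc]
  rw [Finset.sum_ite_eq' Finset.univ e, if_pos (Finset.mem_univ e)]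
  by_cases hi : i = (pos e).1
  · by_cases hj : j = (pos e).2
    · rw [hi, hj, Pi.single_eq_same, Pi.single_eq_same, mul_one, if_pos (Prod.mk.eta)]
    · rw [Pi.single_eq_of_ne hj, mul_zero, if_neg]
      intro h
      exact hj (by rw [h])
  · rw [Pi.single_eq_of_ne hi, zero_mul, if_neg]
    intro h
    exact hi (by rw [h])

/-- ★ **EVERY NILPOTENT PATTERN PENCIL IS (c)-CHEAP** (`c = 3`, `n₀ = 0`): `(patPencil pos) ^ H = 0 → RelCert n m (patPencil pos) (3·(⌊√n⌋·m))`,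
with NO hypothesis on the placement `pos`. [this file] -/
theorem relCert_patPencil_of_pow_eq_zero (pos : Fin n × Fin n → Fin m × Fin m) {H : ℕ} (hnil : (patPencil pos) ^ H = 0) :
    RelCert n m (patPencil pos) (3 * (Nat.sqrt n * m)) :=
  relCert_of_rankOne_generated (patPencil pos) (isAffine_patPencil pos) hnil (coeff_zero_patPencil pos)
    (fun e => Pi.single (pos e).1 (1 : ℂ)) (fun e => Pi.single (pos e).2 (1 : ℂ)) (fun e i j => coeff_single_patPencil pos e i j)

end Summit.ValiantsHypothesis.ValiantsHypothesis.Theorems.GrenetZeon.LongMassRankOne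

end
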